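import Summits.NavierStokesRegularity.TurbBounds.Results.P2R0
import Summits.NavierStokesRegularity.TurbBounds.TailPolyP2R0
import Summits.NavierStokesRegularity.TurbBounds.LayerDensity
import HarnessLib

/-!
# Row P2-R0: the Legendre TAIL LEMMA `Results.P2R0.TailLemma` PROVED, and the row theorem from ONE named hypothesis
(cell `pub-turb` / `turb-bounds`; v2 staging — discharges the second named hypothesis of the Results chain for the soundness row
P2-R0; written by pub-turb-cert, prover-pub-turb-cert-g5-0, 2026-08-21.)

HONEST FRAMING: rigorous bounds for the stated PDE and boundary conditions; no claim about physical turbulence beyond the bound.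
WHAT IS KERNEL-CHECKED HERE (no `sorry`, no `native_decide`, standard axioms): `tailLemma : Results.P2R0.TailLemma` — for every
real `K > 0` and rational `ε > 0`, IF the literal 13 × 13 element matrix `Certs.P2R0.Evaluator.MelR ε (1/K) K` is positive
semidefinite and the two scalar tail slacks hold, THEN the rescaled layer form SPEC-P2 (1.1) of the member `(3/2, 4, η′ ≡ 1)` is
`≥ 0` on the one-sided class `V ∈ C²`, `Θ ∈ C¹`, `V(-1) = V'(-1) = Θ(-1) = 0`. Chain (all in the tree / these staged files):
Legendre expansion + finite Parseval + integration ladder (`LegendreCoeffs`, on the tree's Rodrigues `legendre`), the `ℓ²` tail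
lemma of rbsdp SPEC 3.4 (`LadderTail`), the split inequality SPEC 3.5–3.7 for `(N, P) = (4, 0)` (`TailSeqP2R0`), the identity
'quadratic form of the literal rule = tracked finite part' (`TailBridgeP2R0`, kernel arithmetic on the EvalData matrices),
positivity on polynomial test fields (`TailPolyP2R0`), and Weierstrass density (`LayerDensity`).
CONSEQUENCE: `nusselt_bound_of_layerReduction` — row P2-R0, `Nu ≤ (3/16)·Ra^{1/2} − 1/2` for every `Ra ≥ 64`, now from the SINGLE
named hypothesis `LayerForm.LayerReduction Nu` (the cited background-method reduction [cite: DingKerswell2019, (13)–(16)] with the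
refereed lemmas R-P2a/b); the finite certificate, the cutoff, the cover AND the tail lemma are kernel-checked.
NOT CLAIMED: any formalisation of the Boussinesq reduction itself (`LayerReduction` stays a hypothesis, as in the paper's §3).
-/

set_option linter.style.longLine false

noncomputable section

namespace Summit.NavierStokesRegularity.TurbBounds.Results.P2R0

open Summit.NavierStokesRegularity.TurbBounds.LayerForm

/-- **The tail lemma R-T / R-P2d for the literal P2-R0 element rule, PROVED** (was the named hypothesis `TailLemma`). -/
theorem tailLemma : TailLemma := by
  intro K hK ε hε hM hW hT V Θ hVΘ
  exact LayerDensity.layerForm_nonneg_of_poly continuous_const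
    (fun Vp Θp h0 h1 h2 => TailP2R0.layerForm_poly_nonneg hK hε hM hW hT Vp Θp h0 h1 h2) hVΘ

/-- (★) for the member `(3/2, 4, 1)`, now unconditional: the layer form is `≥ 0` on the one-sided class for every `K > 0`. -/
theorem layer_positivity_holds : LayerPositivity (3 / 2) 4 (fun _ => 1) := layer_positivity tailLemma

/-- **ROW P2-R0 from ONE named hypothesis.** For every quantity `Nu` obeying the background-method layer reduction
(`LayerReduction`, cited + refereed): `Nu(Ra) ≤ (3/16)·Ra^{1/2} − 1/2` for every `Ra ≥ 64`. The tail lemma, the finite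
certificate on the continuum `0 < K ≤ 7/2`, the cutoff and the cover are ALL kernel-checked. -/
theorem nusselt_bound_of_layerReduction (Nu : ℝ → ℝ) (hRed : LayerReduction Nu) :
    ∀ Ra : ℝ, 64 ≤ Ra → Nu Ra ≤ 3 / 16 * Real.sqrt Ra - 1 / 2 :=
  nusselt_bound Nu hRed tailLemma

/-- Vacuity guard, now unconditional: `LayerReduction` is NOT provable for every `Nu` (`Nu ≡ 2` violates it). -/
theorem layerReduction_nontrivial_holds : ¬ LayerReduction (fun _ => 2) := layerReduction_nontrivial tailLemma

end Summit.NavierStokesRegularity.TurbBounds.Results.P2R0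

end
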